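import Summits.ResolutionOfSingularities.ResolutionOfSingularities.Theorems.HomologicalConductorNoZenoSplitCoverFloor
import HarnessLib

/-!
# Crux `NoZenoR` (stmt-ResolutionOfSingularities-19943), row 8⁗ — the SPLITTING CRITERION behind
# THEOREM 17.1: pulling a cover sequence back along a homothety `x`, and «`x` stably annihilates»

Route `ResolutionOfSingularities/HomologicalConductor`, chain W4.4, KERNEL-g17 §6 (lead g17; LEMMA 6.1,
the engine of PROPOSITION 6.2 and THEOREM 17.1 «TR² ⊆ ca(⅟5(1,3,2)) ⊆ TR, y₂y₃ ∉ ca»).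
`[OURS]` — AI-formalised, weaker than expert review; NOT a statement of any manuscript under review.

LEMMA 6.1 of KERNEL-g17 says: for a finitely generated module `N` over a local ring, `x ∈ 𝔪` regular
on `N`, and the minimal cover `0 → ΩN → P → N → 0` with class `ξ_N ∈ Ext¹(N, ΩN)`, the first syzygy of
`N/xN` sits in `0 → ΩN → Ω(N/xN) → N → 0`, which is the PULLBACK of the cover sequence along `x · 1_N`;
its class is `x · ξ_N`, so it splits (`Ω(N/xN) ≅ N ⊕ ΩN`) iff `x · ξ_N = 0` iff `x · 1_N` lifts to `P`
iff `x ∈ sann(N)`. This file is the categorical core of that statement, for any morphism of short exact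
sequences `φ : T ⟶ S` over an `R`-linear abelian category whose first component is an isomorphism and
whose third component is `x •` (an isomorphism) — the pullback along the homothety being the model:

* `extClass_comp_eq_smul_of_hom` — `[T] ∘ φ₁ = x • (ψ ∘ [S])` when `φ₃ = x • ψ`
  (Mathlib's `ShortExact.extClass_naturality`);
* `smul_extClass_eq_zero_iff_exists_lift` — `x • [S] = 0 ↔ ∃ h : S.X₃ ⟶ S.X₂, h ≫ S.g = x • 𝟙`
  («`x` acts on `S.X₃` through the middle term»; for `S.X₂` projective: `x ∈ sann(S.X₃)`), assembling
  `exists_comp_eq_smul_id_X₃_of_smul_extClass_eq_zero` of the tree with its converse;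
* `extClass_eq_zero_of_hom_of_smul_extClass_eq_zero`, `splitting_of_hom_of_smul_extClass_eq_zero` —
  if `φ₁` is an isomorphism, `φ₃ = x • ψ` and `x • [S] = 0`, then `[T] = 0` and `T` splits
  (a retraction from `exists_comp_eq_smul_id_of_smul_extClass_eq_zero` with `c = 1`);
* `smul_extClass_eq_zero_of_hom_of_splitting` — conversely, if moreover `ψ` is an isomorphism and `T`
  splits then `x • [S] = 0`.

So, in the model: `Ω(N/xN) ≅ N ⊕ ΩN ⟺ x ∈ sann_R(N)` — the dichotomy used three times along a minimal
reduction in PROP 6.2 (an Ulrich MCM `Y` with `𝔪 ⊆ sann Y` is a summand of `Ω^d k^{μ(Y)}`), whence, with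
the computed indecomposable summands of `Ω³k` (ranks 3⁶, 6³) and a rank count, THEOREM 17.1. The
construction of the pullback sequence and its identification with `Ω(N/xN)` are not repeated here
(standard; KERNEL-g17 §6.1): the statements below take the comparison morphism `φ` as a hypothesis.
-/

noncomputable section

-- single-problem summit: the doubled namespace component is forced
set_option linter.dupNamespace false

open CategoryTheory CategoryTheory.Abelian CategoryTheory.Limits
open Literature.RingTheory.CohomologyAnnihilator

universe w t v u

namespace Summit.ResolutionOfSingularities.ResolutionOfSingularities.Theorems.NoZeno.SannSplitting

variable {R : Type t} [Ring R] {C : Type u} [Category.{v} C] [Abelian C] [Linear R C] [HasExt.{w} C]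

/-- **Naturality along a homothety.** For a morphism `φ : T ⟶ S` of short exact sequences whose third
component is `x • ψ`, the classes satisfy `[T] ∘ φ₁ = x • (ψ ∘ [S])` in `Ext¹(T.X₃, S.X₁)`. Model:
`S` = the cover `0 → ΩN → P → N → 0`, `T` its pullback along `x · 1_N`, `φ₁ = 𝟙`, `ψ = 𝟙`: the class of
the pullback is `x · ξ_N`. [this work; KERNEL-g17 LEMMA 6.1] -/
theorem extClass_comp_eq_smul_of_hom {S T : ShortComplex C} (hS : S.ShortExact) (hT : T.ShortExact)
    (φ : T ⟶ S) {x : R} (ψ : T.X₃ ⟶ S.X₃) (hφ : φ.τ₃ = x • ψ) :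
    hT.extClass.comp (Ext.mk₀ φ.τ₁) (add_zero 1) =
      x • ((Ext.mk₀ ψ).comp hS.extClass (zero_add 1)) := by
  rw [hT.extClass_naturality hS φ, hφ, Ext.mk₀_smul, Ext.smul_comp]

/-- **«`x` stably annihilates through the middle term» ⟺ `x • [S] = 0`.** For a short exact
`S : 0 → X₁ → X₂ → X₃ → 0`: `x • [S] = 0` iff the homothety `x • 𝟙 X₃` lifts along `S.g`. When `X₂` is
projective (a cover of `X₃`) the right-hand side says `x ∈ sann(X₃)`; in general it says `x · 1_{X₃}`
factors through `X₂`. [this work; assembles `exists_comp_eq_smul_id_X₃_of_smul_extClass_eq_zero`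
of the tree (IyengarTakahashi2014 Rem. 2.13) with its converse] -/
theorem smul_extClass_eq_zero_iff_exists_lift {S : ShortComplex C} (hS : S.ShortExact) {x : R} :
    x • hS.extClass = 0 ↔ ∃ h : S.X₃ ⟶ S.X₂, h ≫ S.g = x • 𝟙 S.X₃ := by
  refine ⟨exists_comp_eq_smul_id_X₃_of_smul_extClass_eq_zero hS, fun ⟨h, hh⟩ => ?_⟩
  have hx : x • hS.extClass = (Ext.mk₀ (x • 𝟙 S.X₃)).comp hS.extClass (zero_add 1) := by
    rw [Ext.mk₀_smul, Ext.smul_comp, Ext.mk₀_id_comp]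
  rw [hx, ← hh, ← Ext.mk₀_comp_mk₀_assoc, hS.comp_extClass, Ext.comp_zero]

/-- **The pulled-back class vanishes.** If `φ : T ⟶ S` is a morphism of short exact sequences with
`φ₁` an isomorphism and `φ₃ = x • ψ`, and `x • [S] = 0`, then `[T] = 0`. Model: `x ∈ sann(N)` ⇒ the class
`x · ξ_N` of `0 → ΩN → Ω(N/xN) → N → 0` vanishes. [this work; KERNEL-g17 LEMMA 6.1] -/
theorem extClass_eq_zero_of_hom_of_smul_extClass_eq_zero {S T : ShortComplex C} (hS : S.ShortExact)
    (hT : T.ShortExact) (φ : T ⟶ S) [IsIso φ.τ₁] {x : R} (ψ : T.X₃ ⟶ S.X₃) (hφ : φ.τ₃ = x • ψ)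
    (hx : x • hS.extClass = 0) : hT.extClass = 0 := by
  have h1 : hT.extClass.comp (Ext.mk₀ φ.τ₁) (add_zero 1) = 0 := by
    rw [extClass_comp_eq_smul_of_hom hS hT φ ψ hφ, ← Ext.comp_smul, hx, Ext.comp_zero]
  have h2 : hT.extClass = (hT.extClass.comp (Ext.mk₀ φ.τ₁) (add_zero 1)).comp
      (Ext.mk₀ (inv φ.τ₁)) (add_zero 1) := by
    rw [Ext.comp_assoc_of_third_deg_zero, Ext.mk₀_comp_mk₀, IsIso.hom_inv_id, Ext.comp_mk₀_id]
  rw [h2, h1, Ext.zero_comp]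

/-- **Splitting (LEMMA 6.1, «if» direction).** Under the same hypotheses `T` splits; in the model,
`Ω(N/xN) ≅ N ⊕ ΩN` as soon as `x ∈ sann(N)` — the step applied three times along a minimal reduction
in PROP 6.2 of KERNEL-g17 (an Ulrich MCM `Y` with `𝔪 ⊆ sann Y` is a direct summand of `Ω^d k^{μ(Y)}`).
[this work] -/
theorem splitting_of_hom_of_smul_extClass_eq_zero {S T : ShortComplex C} (hS : S.ShortExact)
    (hT : T.ShortExact) (φ : T ⟶ S) [IsIso φ.τ₁] {x : R} (ψ : T.X₃ ⟶ S.X₃) (hφ : φ.τ₃ = x • ψ)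
    (hx : x • hS.extClass = 0) : Nonempty T.Splitting := by
  have h0 : hT.extClass = 0 := extClass_eq_zero_of_hom_of_smul_extClass_eq_zero hS hT φ ψ hφ hx
  obtain ⟨r, hr⟩ := exists_comp_eq_smul_id_of_smul_extClass_eq_zero hT (c := (1 : R))
    (by rw [h0, smul_zero])
  rw [one_smul] at hr
  haveI := hT.epi_g
  exact ⟨ShortComplex.Splitting.ofExactOfRetraction T hT.exact r hr inferInstance⟩

/-- **Splitting (LEMMA 6.1, «only if» direction).** If moreover `ψ` is an isomorphism and `T` splits,
then `x • [S] = 0` (in the model: `Ω(N/xN) ≅ N ⊕ ΩN` compatibly with the sequence forces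
`x ∈ sann(N)`). [this work] -/
theorem smul_extClass_eq_zero_of_hom_of_splitting {S T : ShortComplex C} (hS : S.ShortExact)
    (hT : T.ShortExact) (φ : T ⟶ S) {x : R} (ψ : T.X₃ ⟶ S.X₃) [IsIso ψ] (hφ : φ.τ₃ = x • ψ)
    (sp : T.Splitting) : x • hS.extClass = 0 := by
  have hT0 : hT.extClass = 0 := by
    have h := smul_extClass_eq_zero_of_comp_eq_smul_id hT sp.r (c := (1 : R))
      (by rw [one_smul, sp.f_r])
    rwa [one_smul] at h
  have h1 : (Ext.mk₀ ψ).comp (x • hS.extClass) (zero_add 1) = 0 := by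
    rw [Ext.comp_smul, ← extClass_comp_eq_smul_of_hom hS hT φ ψ hφ, hT0, Ext.zero_comp]
  have h2 : x • hS.extClass =
      (Ext.mk₀ (inv ψ)).comp ((Ext.mk₀ ψ).comp (x • hS.extClass) (zero_add 1)) (zero_add 1) := by
    rw [Ext.mk₀_comp_mk₀_assoc, IsIso.inv_hom_id, Ext.mk₀_id_comp]
  rw [h2, h1, Ext.comp_zero]

/-- **LEMMA 6.1 as an equivalence (categorical core).** With `φ₁`, `ψ` isomorphisms and `φ₃ = x • ψ`:
`T` splits ⟺ `x • [S] = 0` ⟺ `x • 𝟙` lifts along `S.g`. [this work; KERNEL-g17 §6.1] -/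
theorem nonempty_splitting_iff_smul_extClass_eq_zero {S T : ShortComplex C} (hS : S.ShortExact)
    (hT : T.ShortExact) (φ : T ⟶ S) [IsIso φ.τ₁] {x : R} (ψ : T.X₃ ⟶ S.X₃) [IsIso ψ]
    (hφ : φ.τ₃ = x • ψ) : Nonempty T.Splitting ↔ x • hS.extClass = 0 :=
  ⟨fun ⟨sp⟩ => smul_extClass_eq_zero_of_hom_of_splitting hS hT φ ψ hφ sp,
    fun hx => splitting_of_hom_of_smul_extClass_eq_zero hS hT φ ψ hφ hx⟩

end Summit.ResolutionOfSingularities.ResolutionOfSingularities.Theorems.NoZeno.SannSplitting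

end
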